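import Summits.CriticalPhenomena.CardyFormulaZ2.Theorems.CardySusyWardDiscretisationFamilyExistsTransportD
import HarnessLib

/-!
# Axis-aligned interior/exterior pairs and the standard orientation — helper for `DiscretisationFamilyExists` (stmt-CriticalPhenomena-9644)

* `exists_aligned_pair`: near a frontier point of a regular open set `Ω` (frontier accessible from
  the exterior) there are a point `p ∈ Ω` and a point `q` of the exterior `(closure Ω)ᶜ` on a
  common vertical or horizontal line.  (Elementary: if the exterior avoided both the vertical and
  the horizontal strip through a small disc of `Ω`, the corner point `(p₀.re, q₀.im)` would be
  neither exterior, nor in `Ω`, nor on the frontier.)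
* `exists_standard_iso`: one of the four quarter turns (as lattice isometries of
  `…ExistsTransportD`, or the identity) puts `q` straight below `p`.
-/

noncomputable section

open Set Metric Complex
open Literature.Probability.LatticeModels Literature.Probability.Percolation
  Literature.Probability.LatticeModels.DiscreteDobrushin

namespace Summit.CriticalPhenomena.CardyFormulaZ2.Theorems.DiscretisationFamilyExists

/-- Distance of a "corner point" `(x.re, y.im)` to `a`. [folklore] -/
theorem dist_mk_re_im_lt {x y a : ℂ} {ρ : ℝ} (hx : dist x a < ρ / 2) (hy : dist y a < ρ / 2) :
    dist (⟨x.re, y.im⟩ : ℂ) a < ρ := by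
  rw [Complex.dist_eq] at hx hy ⊢
  have h1 := abs_re_le_norm (x - a)
  have h2 := abs_im_le_norm (y - a)
  refine (norm_le_abs_re_add_abs_im _).trans_lt ?_
  simp only [sub_re, sub_im] at h1 h2 ⊢
  linarith

/-- **Axis-aligned interior/exterior pair near a frontier point.** [folklore] -/
theorem exists_aligned_pair {Ω : Set ℂ} (hΩ : IsOpen Ω) (hJE : frontier Ω ⊆ closure (closure Ω)ᶜ)
    {a : ℂ} (ha : a ∈ frontier Ω) {ρ : ℝ} (hρ : 0 < ρ) :
    ∃ p q : ℂ, p ∈ Ω ∧ q ∈ (closure Ω)ᶜ ∧ p ∈ ball a ρ ∧ q ∈ ball a ρ ∧ (p.re = q.re ∨ p.im = q.im) := by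
  have hρ4 : 0 < ρ / 4 := by positivity
  obtain ⟨p₀, hp₀b, hp₀Ω⟩ : (ball a (ρ / 4) ∩ Ω).Nonempty :=
    mem_closure_iff_nhds.1 (frontier_subset_closure ha) _ (ball_mem_nhds a hρ4)
  obtain ⟨q₀, hq₀b, hq₀e⟩ : (ball a (ρ / 4) ∩ (closure Ω)ᶜ).Nonempty :=
    mem_closure_iff_nhds.1 (hJE ha) _ (ball_mem_nhds a hρ4)
  obtain ⟨r₀, hr₀, hr₀Ω⟩ := Metric.isOpen_iff.1 hΩ p₀ hp₀Ω
  set r := min r₀ (ρ / 4) with hr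
  have hr0 : 0 < r := lt_min hr₀ hρ4
  have hrΩ : ball p₀ r ⊆ Ω := (ball_subset_ball (min_le_left _ _)).trans hr₀Ω
  have hp₀b' : dist p₀ a < ρ / 2 := lt_of_lt_of_le (mem_ball.1 hp₀b) (by linarith)
  have hq₀b' : dist q₀ a < ρ / 2 := lt_of_lt_of_le (mem_ball.1 hq₀b) (by linarith)
  have hp₀b4 : dist p₀ a < ρ / 4 := hp₀b
  -- an exterior point in the vertical strip through `ball p₀ r` gives a vertical pair
  by_cases hv : ∃ q ∈ ball a ρ, q ∈ (closure Ω)ᶜ ∧ |q.re - p₀.re| < r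
  · obtain ⟨q, hqb, hqe, hqre⟩ := hv
    refine ⟨⟨q.re, p₀.im⟩, q, hrΩ ?_, hqe, ?_, hqb, Or.inl rfl⟩
    · rw [mem_ball, Complex.dist_eq]
      refine (norm_le_abs_re_add_abs_im _).trans_lt ?_
      simp only [sub_re, sub_im, sub_self, abs_zero, add_zero]; exact hqre
    · rw [mem_ball, Complex.dist_eq]
      refine (norm_le_abs_re_add_abs_im _).trans_lt ?_
      have h1 := abs_re_le_norm (p₀ - a)
      have h2 := abs_im_le_norm (p₀ - a)
      rw [Complex.dist_eq] at hp₀b4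
      simp only [sub_re, sub_im] at h1 h2 ⊢
      have h3 : |q.re - a.re| ≤ |q.re - p₀.re| + |p₀.re - a.re| := abs_sub_le _ _ _
      have h4 : r ≤ ρ / 4 := min_le_right _ _
      linarith
  -- the corner point
  set c : ℂ := ⟨p₀.re, q₀.im⟩ with hc
  have hcb : dist c a < ρ := dist_mk_re_im_lt hp₀b' hq₀b'
  by_cases hcΩ : c ∈ Ω
  · exact ⟨c, q₀, hcΩ, hq₀e, hcb, ball_subset_ball (by linarith) hq₀b, Or.inr rfl⟩
  exfalso
  have hce : c ∉ (closure Ω)ᶜ := fun h => hv ⟨c, hcb, h, by simp [hc, hr0]⟩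
  have hcfr : c ∈ frontier Ω := by
    rw [hΩ.frontier_eq]; exact ⟨not_notMem.1 hce, hcΩ⟩
  -- exterior points accumulate at `c`: one of them is in the vertical strip
  have hε : 0 < min r (ρ - dist c a) := lt_min hr0 (by linarith)
  obtain ⟨e, heb, hee⟩ : (ball c (min r (ρ - dist c a)) ∩ (closure Ω)ᶜ).Nonempty :=
    mem_closure_iff_nhds.1 (hJE hcfr) _ (ball_mem_nhds c hε)
  refine hv ⟨e, ?_, hee, ?_⟩
  · rw [mem_ball] at heb ⊢
    have := dist_triangle e c a
    linarith [heb.trans_le (min_le_right _ _)]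
  · rw [mem_ball, Complex.dist_eq] at heb
    have h1 := abs_re_le_norm (e - c)
    simp only [sub_re] at h1
    exact h1.trans_lt (heb.trans_le (min_le_left _ _))

/-- The identity as a lattice isometry. [folklore] -/
theorem exists_latticeIso_id (δ : ℝ) :
    ∃ (g gf : Site 2 ≃ Site 2) (G : ℂ ≃ₗᵢ[ℝ] ℂ) (π : Fin 4 → Fin 4),
      (∀ x, meshPoint δ (g x) = G (meshPoint δ x)) ∧
      (∀ x f, IsCorner (g x) (gf f) ↔ IsCorner x f) ∧
      (∀ x m, g.symm (x + cornerUnit m) = g.symm x + cornerUnit (π m)) ∧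
      (∀ m, cornerUnit (π (m + 1)) = cornerUnit (π m + 1) ∨ cornerUnit (π (m + 1)) = -cornerUnit (π m + 1)) ∧
      (∀ z, G z = z) :=
  ⟨Equiv.refl _, Equiv.refl _, LinearIsometryEquiv.refl ℝ ℂ, id, fun _ => rfl, fun _ _ => Iff.rfl,
    fun _ _ => rfl, fun _ => Or.inl rfl, fun _ => rfl⟩

/-- **Standard orientation.** For an axis-aligned pair `p ≠ q` one of the four quarter turns
(a lattice isometry with the transport package) puts `q` straight below `p`. [folklore] -/
theorem exists_standard_iso (δ : ℝ) {p q : ℂ} (hpq : p ≠ q) (hal : p.re = q.re ∨ p.im = q.im) :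
    ∃ (g gf : Site 2 ≃ Site 2) (G : ℂ ≃ₗᵢ[ℝ] ℂ) (π : Fin 4 → Fin 4),
      (∀ x, meshPoint δ (g x) = G (meshPoint δ x)) ∧
      (∀ x f, IsCorner (g x) (gf f) ↔ IsCorner x f) ∧
      (∀ x m, g.symm (x + cornerUnit m) = g.symm x + cornerUnit (π m)) ∧
      (∀ m, cornerUnit (π (m + 1)) = cornerUnit (π m + 1) ∨ cornerUnit (π (m + 1)) = -cornerUnit (π m + 1)) ∧
      (G q).re = (G p).re ∧ (G q).im < (G p).im := by
  have hne : p.re ≠ q.re ∨ p.im ≠ q.im := by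
    by_contra h; push Not at h; exact hpq (Complex.ext h.1 h.2)
  rcases hal with h | h
  · -- vertical pair
    have him : p.im ≠ q.im := by rcases hne with h' | h'; exact absurd h h'; exact h'
    rcases lt_or_gt_of_ne him with hlt | hlt
    · -- `q` above `p`: half turn
      obtain ⟨g, gf, G, π, h1, h2, h3, h4, hG, -, -⟩ := exists_latticeIso_neg δ
      exact ⟨g, gf, G, π, h1, h2, h3, h4, by rw [hG, hG]; simp [h], by rw [hG, hG]; simp; linarith⟩
    · -- `q` below `p`: identity
      obtain ⟨g, gf, G, π, h1, h2, h3, h4, hG⟩ := exists_latticeIso_id δ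
      exact ⟨g, gf, G, π, h1, h2, h3, h4, by rw [hG, hG]; exact h.symm, by rw [hG, hG]; exact hlt⟩
  · -- horizontal pair
    have hre : p.re ≠ q.re := by rcases hne with h' | h'; exact h'; exact absurd h h'
    rcases lt_or_gt_of_ne hre with hlt | hlt
    · -- `q` east of `p`: turn by `-I`
      obtain ⟨g, gf, G, π, h1, h2, h3, h4, hG, -, -⟩ := exists_latticeIso_rotNegI δ
      refine ⟨g, gf, G, π, h1, h2, h3, h4, ?_, ?_⟩ <;> rw [hG, hG] <;> simp [h] ; linarith
    · -- `q` west of `p`: turn by `I`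
      obtain ⟨g, gf, G, π, h1, h2, h3, h4, hG, -, -⟩ := exists_latticeIso_rotI δ
      refine ⟨g, gf, G, π, h1, h2, h3, h4, ?_, ?_⟩ <;> rw [hG, hG] <;> simp [h] ; linarith

end Summit.CriticalPhenomena.CardyFormulaZ2.Theorems.DiscretisationFamilyExists

end
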